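import Summits.CriticalPhenomena.PercolationContinuityZ3.Theorems.PercNearOneGluingNoHeavyLowerTailThreePointProductFormFibreParallelFamily
import HarnessLib

/-!
# Parallel composition at the three terminals, VI: families of pieces — `Ga`, `Gb`, `G1` (Sahi programme, prover prim-sahi-p2 gen 59)

Support file (`--supports stmt-CriticalPhenomena-4575`, helper); continues `…ThreePointProductFormFibreParallelFamily` (same gen).
Standard axioms, no sorries, no named facts, no definitions.  Memo `run/shared/lean/prim/prim-sahi/FROM-prim-sahi-p2-gen59-ONE-STEP-LEMMA.md` §3, §8(2).

**`card_parallel_family_Ga/Gb/G1`**: for a finite family of pieces (masks `mp j`, `j ∈ J`) with pairwise disjoint masks living on pairwise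
disjoint terminal-free vertex classes `Pp j` (each `mp j`-label has its endpoints in `Pp j ∪ {s,a,c}`), and distinct terminals,
`N_E(fun l => decide (∃ j ∈ J, mp j l)) · U^{#J} = U · ∏_{j∈J} N_E(mp j)` with `U = 2^{#α}` — the n-ary parallel composition law at `{s,a,c}`
(gen 53 (63k)) for the three flat statistics (`Ga = S0 ∧ c isolated in the restricted flat`, `Gb`, `G1`).  Induction on `J` with the binary mask law (part IV).
[this work] (gen 59).
-/

namespace Summit.CriticalPhenomena.PercolationContinuityZ3.Theorems.ProductFormFibre

open Finset Literature.Probability.Percolation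
open Summit.CriticalPhenomena.PercolationContinuityZ3.Theorems.ThreePointCPIClusterSwap (clusterFlip)

variable {V α : Type*}

/-! ### Families of pieces, flat statistics -/

section FamilyFlat

variable [Fintype α] [DecidableEq α] [DecidableEq V] {β : Type*} [DecidableEq β]
  (ends : α → Sym2 V) (s a c : V) (mp : β → α → Bool) (Pp : β → V → Prop)

open Classical in
/-- **n-ary parallel composition, `Ga`**: `N(⋁_J masks) · U^{#J} = U · ∏_J N(mask_j)`. [this work] -/
theorem card_parallel_family_Ga
    (hsa : s ≠ a) (hca : c ≠ a) (hsc : s ≠ c) (J : Finset β)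
    (hQP : ∀ j ∈ J, ∀ l, mp j l = true → ∀ v ∈ ends l, Pp j v ∨ (v = s ∨ v = a ∨ v = c))
    (hPT : ∀ j ∈ J, ∀ v, Pp j v → ¬ (v = s ∨ v = a ∨ v = c))
    (hP : ∀ j ∈ J, ∀ j' ∈ J, j ≠ j' → ∀ v, Pp j v → ¬ Pp j' v)
    (hQ : ∀ j ∈ J, ∀ j' ∈ J, j ≠ j' → ∀ l, mp j l = true → ¬ mp j' l = true) :
    (univ.filter fun z : α → Bool =>
        (((¬ (openGraph (labelledOpen ends (fun y => z y && decide (∃ j ∈ J, mp j y = true)))).Reachable s a ∧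
        ¬ (openGraph (labelledOpen ends (fun y => z y && decide (∃ j ∈ J, mp j y = true)))).Reachable s c) ∧
        (¬ (openGraph (labelledOpen ends (fun y => z y && decide (∃ j ∈ J, mp j y = true)))).Reachable c a ∧
        ¬ (openGraph (labelledOpen ends (fun y => z y && decide (∃ j ∈ J, mp j y = true)))).Reachable c s)) ∧
        (¬ (openGraph (labelledOpen ends (fun l =>
          clusterFlip ends a (fun y => !(z y && decide (∃ j ∈ J, mp j y = true))) l && decide (∃ j ∈ J, mp j l = true)))).Reachable c a ∧
        ¬ (openGraph (labelledOpen ends (fun l =>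
          clusterFlip ends a (fun y => !(z y && decide (∃ j ∈ J, mp j y = true))) l && decide (∃ j ∈ J, mp j l = true)))).Reachable c s))).card *
      (univ : Finset (α → Bool)).card ^ J.card =
    (univ : Finset (α → Bool)).card *
    ∏ j ∈ J, (univ.filter fun z : α → Bool =>
        (((¬ (openGraph (labelledOpen ends (fun y => z y && mp j y))).Reachable s a ∧
        ¬ (openGraph (labelledOpen ends (fun y => z y && mp j y))).Reachable s c) ∧
        (¬ (openGraph (labelledOpen ends (fun y => z y && mp j y))).Reachable c a ∧
        ¬ (openGraph (labelledOpen ends (fun y => z y && mp j y))).Reachable c s)) ∧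
        (¬ (openGraph (labelledOpen ends (fun l =>
          clusterFlip ends a (fun y => !(z y && mp j y)) l && mp j l))).Reachable c a ∧
        ¬ (openGraph (labelledOpen ends (fun l =>
          clusterFlip ends a (fun y => !(z y && mp j y)) l && mp j l))).Reachable c s))).card := by
  induction J using Finset.induction_on with
  | empty =>
    have h0 := card_Ga_mask_false ends s a c hsa hca hsc
    have e : (fun z : α → Bool => fun y => z y && decide (∃ j ∈ (∅ : Finset β), mp j y = true)) =
        fun z => fun y => z y && false := by
      funext z y; simp
    simp only [Finset.card_empty, pow_zero, mul_one, Finset.prod_empty, Finset.notMem_empty, false_and,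
      exists_false, decide_false] at h0 ⊢
    exact h0
  | insert j₀ J' hj₀ IH =>
    have hQP' : ∀ j ∈ J', ∀ l, mp j l = true → ∀ v ∈ ends l, Pp j v ∨ (v = s ∨ v = a ∨ v = c) :=
      fun j hj => hQP j (Finset.mem_insert_of_mem hj)
    have hPT' : ∀ j ∈ J', ∀ v, Pp j v → ¬ (v = s ∨ v = a ∨ v = c) := fun j hj => hPT j (Finset.mem_insert_of_mem hj)
    have hP' : ∀ j ∈ J', ∀ j' ∈ J', j ≠ j' → ∀ v, Pp j v → ¬ Pp j' v :=
      fun j hj j' hj' => hP j (Finset.mem_insert_of_mem hj) j' (Finset.mem_insert_of_mem hj')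
    have hQ' : ∀ j ∈ J', ∀ j' ∈ J', j ≠ j' → ∀ l, mp j l = true → ¬ mp j' l = true :=
      fun j hj j' hj' => hQ j (Finset.mem_insert_of_mem hj) j' (Finset.mem_insert_of_mem hj')
    have IH' := IH hQP' hPT' hP' hQ'
    -- the binary law for (piece j₀, union of J')
    have hbin := card_parallel_Ga_mask ends s a c (mp j₀) (fun l => decide (∃ j ∈ J', mp j l = true)) (Pp j₀)
      (fun v => ∃ j ∈ J', Pp j v)
      (hQP j₀ (Finset.mem_insert_self j₀ J'))
      (fun l hl v hv => by
        simp only [decide_eq_true_eq] at hl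
        obtain ⟨j, hj, hjl⟩ := hl
        rcases hQP j (Finset.mem_insert_of_mem hj) l hjl v hv with h | h
        · exact Or.inl ⟨j, hj, h⟩
        · exact Or.inr h)
      (hPT j₀ (Finset.mem_insert_self j₀ J'))
      (fun v ⟨j, hj, hjv⟩ => hPT j (Finset.mem_insert_of_mem hj) v hjv)
      (fun v hv ⟨j, hj, hjv⟩ => hP j₀ (Finset.mem_insert_self j₀ J') j (Finset.mem_insert_of_mem hj)
        (fun h => hj₀ (h ▸ hj)) v hv hjv)
      (fun l hl hl' => by
        simp only [decide_eq_true_eq] at hl'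
        obtain ⟨j, hj, hjl⟩ := hl'
        exact hQ j₀ (Finset.mem_insert_self j₀ J') j (Finset.mem_insert_of_mem hj) (fun h => hj₀ (h ▸ hj)) l hl hjl)
    simp only [unionMask_insert mp J' j₀]
    rw [Finset.card_insert_of_notMem hj₀, Finset.prod_insert hj₀]
    exact family_arith _ _ _ _ _ _ hbin IH'


open Classical in
/-- **n-ary parallel composition, `Gb`**: `N(⋁_J masks) · U^{#J} = U · ∏_J N(mask_j)`. [this work] -/
theorem card_parallel_family_Gb
    (hsa : s ≠ a) (hca : c ≠ a) (hsc : s ≠ c) (J : Finset β)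
    (hQP : ∀ j ∈ J, ∀ l, mp j l = true → ∀ v ∈ ends l, Pp j v ∨ (v = s ∨ v = a ∨ v = c))
    (hPT : ∀ j ∈ J, ∀ v, Pp j v → ¬ (v = s ∨ v = a ∨ v = c))
    (hP : ∀ j ∈ J, ∀ j' ∈ J, j ≠ j' → ∀ v, Pp j v → ¬ Pp j' v)
    (hQ : ∀ j ∈ J, ∀ j' ∈ J, j ≠ j' → ∀ l, mp j l = true → ¬ mp j' l = true) :
    (univ.filter fun z : α → Bool =>
        (((¬ (openGraph (labelledOpen ends (fun y => z y && decide (∃ j ∈ J, mp j y = true)))).Reachable s a ∧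
        ¬ (openGraph (labelledOpen ends (fun y => z y && decide (∃ j ∈ J, mp j y = true)))).Reachable s c) ∧
        (¬ (openGraph (labelledOpen ends (fun y => z y && decide (∃ j ∈ J, mp j y = true)))).Reachable c a ∧
        ¬ (openGraph (labelledOpen ends (fun y => z y && decide (∃ j ∈ J, mp j y = true)))).Reachable c s)) ∧
        (¬ (openGraph (labelledOpen ends (fun l =>
          clusterFlip ends a (fun y => !(z y && decide (∃ j ∈ J, mp j y = true))) l && decide (∃ j ∈ J, mp j l = true)))).Reachable s a ∧
        ¬ (openGraph (labelledOpen ends (fun l =>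
          clusterFlip ends a (fun y => !(z y && decide (∃ j ∈ J, mp j y = true))) l && decide (∃ j ∈ J, mp j l = true)))).Reachable s c))).card *
      (univ : Finset (α → Bool)).card ^ J.card =
    (univ : Finset (α → Bool)).card *
    ∏ j ∈ J, (univ.filter fun z : α → Bool =>
        (((¬ (openGraph (labelledOpen ends (fun y => z y && mp j y))).Reachable s a ∧
        ¬ (openGraph (labelledOpen ends (fun y => z y && mp j y))).Reachable s c) ∧
        (¬ (openGraph (labelledOpen ends (fun y => z y && mp j y))).Reachable c a ∧
        ¬ (openGraph (labelledOpen ends (fun y => z y && mp j y))).Reachable c s)) ∧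
        (¬ (openGraph (labelledOpen ends (fun l =>
          clusterFlip ends a (fun y => !(z y && mp j y)) l && mp j l))).Reachable s a ∧
        ¬ (openGraph (labelledOpen ends (fun l =>
          clusterFlip ends a (fun y => !(z y && mp j y)) l && mp j l))).Reachable s c))).card := by
  induction J using Finset.induction_on with
  | empty =>
    have h0 := card_Gb_mask_false ends s a c hsa hca hsc
    have e : (fun z : α → Bool => fun y => z y && decide (∃ j ∈ (∅ : Finset β), mp j y = true)) =
        fun z => fun y => z y && false := by
      funext z y; simp
    simp only [Finset.card_empty, pow_zero, mul_one, Finset.prod_empty, Finset.notMem_empty, false_and,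
      exists_false, decide_false] at h0 ⊢
    exact h0
  | insert j₀ J' hj₀ IH =>
    have hQP' : ∀ j ∈ J', ∀ l, mp j l = true → ∀ v ∈ ends l, Pp j v ∨ (v = s ∨ v = a ∨ v = c) :=
      fun j hj => hQP j (Finset.mem_insert_of_mem hj)
    have hPT' : ∀ j ∈ J', ∀ v, Pp j v → ¬ (v = s ∨ v = a ∨ v = c) := fun j hj => hPT j (Finset.mem_insert_of_mem hj)
    have hP' : ∀ j ∈ J', ∀ j' ∈ J', j ≠ j' → ∀ v, Pp j v → ¬ Pp j' v :=
      fun j hj j' hj' => hP j (Finset.mem_insert_of_mem hj) j' (Finset.mem_insert_of_mem hj')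
    have hQ' : ∀ j ∈ J', ∀ j' ∈ J', j ≠ j' → ∀ l, mp j l = true → ¬ mp j' l = true :=
      fun j hj j' hj' => hQ j (Finset.mem_insert_of_mem hj) j' (Finset.mem_insert_of_mem hj')
    have IH' := IH hQP' hPT' hP' hQ'
    -- the binary law for (piece j₀, union of J')
    have hbin := card_parallel_Gb_mask ends s a c (mp j₀) (fun l => decide (∃ j ∈ J', mp j l = true)) (Pp j₀)
      (fun v => ∃ j ∈ J', Pp j v)
      (hQP j₀ (Finset.mem_insert_self j₀ J'))
      (fun l hl v hv => by
        simp only [decide_eq_true_eq] at hl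
        obtain ⟨j, hj, hjl⟩ := hl
        rcases hQP j (Finset.mem_insert_of_mem hj) l hjl v hv with h | h
        · exact Or.inl ⟨j, hj, h⟩
        · exact Or.inr h)
      (hPT j₀ (Finset.mem_insert_self j₀ J'))
      (fun v ⟨j, hj, hjv⟩ => hPT j (Finset.mem_insert_of_mem hj) v hjv)
      (fun v hv ⟨j, hj, hjv⟩ => hP j₀ (Finset.mem_insert_self j₀ J') j (Finset.mem_insert_of_mem hj)
        (fun h => hj₀ (h ▸ hj)) v hv hjv)
      (fun l hl hl' => by
        simp only [decide_eq_true_eq] at hl'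
        obtain ⟨j, hj, hjl⟩ := hl'
        exact hQ j₀ (Finset.mem_insert_self j₀ J') j (Finset.mem_insert_of_mem hj) (fun h => hj₀ (h ▸ hj)) l hl hjl)
    simp only [unionMask_insert mp J' j₀]
    rw [Finset.card_insert_of_notMem hj₀, Finset.prod_insert hj₀]
    exact family_arith _ _ _ _ _ _ hbin IH'


open Classical in
/-- **n-ary parallel composition, `G1`**: `N(⋁_J masks) · U^{#J} = U · ∏_J N(mask_j)`. [this work] -/
theorem card_parallel_family_G1
    (hsa : s ≠ a) (hca : c ≠ a) (hsc : s ≠ c) (J : Finset β)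
    (hQP : ∀ j ∈ J, ∀ l, mp j l = true → ∀ v ∈ ends l, Pp j v ∨ (v = s ∨ v = a ∨ v = c))
    (hPT : ∀ j ∈ J, ∀ v, Pp j v → ¬ (v = s ∨ v = a ∨ v = c))
    (hP : ∀ j ∈ J, ∀ j' ∈ J, j ≠ j' → ∀ v, Pp j v → ¬ Pp j' v)
    (hQ : ∀ j ∈ J, ∀ j' ∈ J, j ≠ j' → ∀ l, mp j l = true → ¬ mp j' l = true) :
    (univ.filter fun z : α → Bool =>
        (((¬ (openGraph (labelledOpen ends (fun y => z y && decide (∃ j ∈ J, mp j y = true)))).Reachable s a ∧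
        ¬ (openGraph (labelledOpen ends (fun y => z y && decide (∃ j ∈ J, mp j y = true)))).Reachable s c) ∧
        (¬ (openGraph (labelledOpen ends (fun y => z y && decide (∃ j ∈ J, mp j y = true)))).Reachable c a ∧
        ¬ (openGraph (labelledOpen ends (fun y => z y && decide (∃ j ∈ J, mp j y = true)))).Reachable c s)) ∧
        ((¬ (openGraph (labelledOpen ends (fun l =>
          clusterFlip ends a (fun y => !(z y && decide (∃ j ∈ J, mp j y = true))) l && decide (∃ j ∈ J, mp j l = true)))).Reachable s a ∧
        ¬ (openGraph (labelledOpen ends (fun l =>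
          clusterFlip ends a (fun y => !(z y && decide (∃ j ∈ J, mp j y = true))) l && decide (∃ j ∈ J, mp j l = true)))).Reachable s c) ∧
        (¬ (openGraph (labelledOpen ends (fun l =>
          clusterFlip ends a (fun y => !(z y && decide (∃ j ∈ J, mp j y = true))) l && decide (∃ j ∈ J, mp j l = true)))).Reachable c a ∧
        ¬ (openGraph (labelledOpen ends (fun l =>
          clusterFlip ends a (fun y => !(z y && decide (∃ j ∈ J, mp j y = true))) l && decide (∃ j ∈ J, mp j l = true)))).Reachable c s)))).card *
      (univ : Finset (α → Bool)).card ^ J.card =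
    (univ : Finset (α → Bool)).card *
    ∏ j ∈ J, (univ.filter fun z : α → Bool =>
        (((¬ (openGraph (labelledOpen ends (fun y => z y && mp j y))).Reachable s a ∧
        ¬ (openGraph (labelledOpen ends (fun y => z y && mp j y))).Reachable s c) ∧
        (¬ (openGraph (labelledOpen ends (fun y => z y && mp j y))).Reachable c a ∧
        ¬ (openGraph (labelledOpen ends (fun y => z y && mp j y))).Reachable c s)) ∧
        ((¬ (openGraph (labelledOpen ends (fun l =>
          clusterFlip ends a (fun y => !(z y && mp j y)) l && mp j l))).Reachable s a ∧
        ¬ (openGraph (labelledOpen ends (fun l =>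
          clusterFlip ends a (fun y => !(z y && mp j y)) l && mp j l))).Reachable s c) ∧
        (¬ (openGraph (labelledOpen ends (fun l =>
          clusterFlip ends a (fun y => !(z y && mp j y)) l && mp j l))).Reachable c a ∧
        ¬ (openGraph (labelledOpen ends (fun l =>
          clusterFlip ends a (fun y => !(z y && mp j y)) l && mp j l))).Reachable c s)))).card := by
  induction J using Finset.induction_on with
  | empty =>
    have h0 := card_G1_mask_false ends s a c hsa hca hsc
    have e : (fun z : α → Bool => fun y => z y && decide (∃ j ∈ (∅ : Finset β), mp j y = true)) =
        fun z => fun y => z y && false := by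
      funext z y; simp
    simp only [Finset.card_empty, pow_zero, mul_one, Finset.prod_empty, Finset.notMem_empty, false_and,
      exists_false, decide_false] at h0 ⊢
    exact h0
  | insert j₀ J' hj₀ IH =>
    have hQP' : ∀ j ∈ J', ∀ l, mp j l = true → ∀ v ∈ ends l, Pp j v ∨ (v = s ∨ v = a ∨ v = c) :=
      fun j hj => hQP j (Finset.mem_insert_of_mem hj)
    have hPT' : ∀ j ∈ J', ∀ v, Pp j v → ¬ (v = s ∨ v = a ∨ v = c) := fun j hj => hPT j (Finset.mem_insert_of_mem hj)
    have hP' : ∀ j ∈ J', ∀ j' ∈ J', j ≠ j' → ∀ v, Pp j v → ¬ Pp j' v :=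
      fun j hj j' hj' => hP j (Finset.mem_insert_of_mem hj) j' (Finset.mem_insert_of_mem hj')
    have hQ' : ∀ j ∈ J', ∀ j' ∈ J', j ≠ j' → ∀ l, mp j l = true → ¬ mp j' l = true :=
      fun j hj j' hj' => hQ j (Finset.mem_insert_of_mem hj) j' (Finset.mem_insert_of_mem hj')
    have IH' := IH hQP' hPT' hP' hQ'
    -- the binary law for (piece j₀, union of J')
    have hbin := card_parallel_G1_mask ends s a c (mp j₀) (fun l => decide (∃ j ∈ J', mp j l = true)) (Pp j₀)
      (fun v => ∃ j ∈ J', Pp j v)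
      (hQP j₀ (Finset.mem_insert_self j₀ J'))
      (fun l hl v hv => by
        simp only [decide_eq_true_eq] at hl
        obtain ⟨j, hj, hjl⟩ := hl
        rcases hQP j (Finset.mem_insert_of_mem hj) l hjl v hv with h | h
        · exact Or.inl ⟨j, hj, h⟩
        · exact Or.inr h)
      (hPT j₀ (Finset.mem_insert_self j₀ J'))
      (fun v ⟨j, hj, hjv⟩ => hPT j (Finset.mem_insert_of_mem hj) v hjv)
      (fun v hv ⟨j, hj, hjv⟩ => hP j₀ (Finset.mem_insert_self j₀ J') j (Finset.mem_insert_of_mem hj)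
        (fun h => hj₀ (h ▸ hj)) v hv hjv)
      (fun l hl hl' => by
        simp only [decide_eq_true_eq] at hl'
        obtain ⟨j, hj, hjl⟩ := hl'
        exact hQ j₀ (Finset.mem_insert_self j₀ J') j (Finset.mem_insert_of_mem hj) (fun h => hj₀ (h ▸ hj)) l hl hjl)
    simp only [unionMask_insert mp J' j₀]
    rw [Finset.card_insert_of_notMem hj₀, Finset.prod_insert hj₀]
    exact family_arith _ _ _ _ _ _ hbin IH'


end FamilyFlat

end Summit.CriticalPhenomena.PercolationContinuityZ3.Theorems.ProductFormFibre
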